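import Summits.BirchSwinnertonDyer.Rank1Residual.Additive.N11KimAtThreeDeepPUB
import Summits.BirchSwinnertonDyer.Rank1Residual.X4.KuriharaLevelLoweringField
import HarnessLib

/-!
# N11 — Tamagawa rows at `p = 3`, every `t`: the level-lowering certificate of cell `b2b-bsdres`
# (seat additive-p4, `X4/KuriharaLevelLoweringField.lean`) + the kim3 CELL THEOREM `KimAtThreeDeepPUB`
# ⟹ `BSD(E,3)` on unit tower rows with `ord₃ ∏ c_ℓ ≤ 2`

HONEST FRAMING. Cell `bsd-addord` (run/shared/lean/pub/bsd-addord/), seat kim3. Seat additive-p4 of cell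
`b2b-bsdres` proved (`bsdp_of_plusSymbolLevelLowersOver_of_tamagawa_le_two_of_shaAn_unit_of_kim2025_OPEN`)
that a `k`-valued level-lowering certificate `PlusSymbolLevelLowersOver W p D.f ι ℓ` at some `ℓ ∣ N_E`
(every mod-`p` Kurihara number vanishes, so `∂^{(∞)}(δ̃) ≥ 1`) closes `BSD(E,p)` on analytic-rank-`0` tower
rows with `#Ш_an` a `p`-unit and `ord_p ∏ c_ℓ ≤ 2` — CONDITIONAL on the ANNOUNCED record
`Kim2025.thm11_kimShaLength_of_integralPeriod_OPEN` (flag `Kim2025-preprint`). This file gives the same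
conclusion at `p = 3` with that binder REPLACED by the kim3 cell theorem's name `KimAtThreeDeepPUB`
(`N11KimAtThreeDeepPUB.lean`: memo `kim3/KIM3-PROOF.md` §14 Theorem A-t (ii), refereed inside the cell,
C15 PASS; its all-levels consumer `padicValNat_sha_add_partialInfty_le_of_kimAtThreeDeepPUB` is exactly the
UPPER inequality `ord₃ #Ш(3) + ∂^{(∞)} ≤ ∂^{(0)}` the argument needs — the deep-limit subtlety of the name
is invisible here because only this inequality is used). Cassels' theorem (`hCT`, `#Ш` is a square) turns
`ord₃ #Ш ≤ 1` into `= 0`. NOTHING is asserted about the certificate: it stays a displayed hypothesis (its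
provenance at `9 ∣ N` is the additive-p4 seat's (MO) question, `X4/KuriharaLevelLoweringOfMultiplicityOne.lean`);
kim3's prediction test P2 (memo §19.1: 0/120 + 0/59 level-1 units on ten `t = 1` Tamagawa rows) is numerical
evidence for it at `p = 3`, nothing more. No booking.

References: [Kim2025RefinedTNC] Thm. 1.1; [Kim2022StructureSelmer] §1.5.1, Conj. 1.10; [Ribet1990] Thm. 1.1;
[MazurRubin2004] Prop. 6.2.6; [SilvermanAEC2009] Thm. X.4.14; [Miller2011LMS] Def. 1.1; memo
`run/shared/lean/pub/bsd-addord/kim3/KIM3-PROOF.md` §14, §19.5 (b).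
-/

noncomputable section

open scoped MatrixGroups ModularForm Classical

open CongruenceSubgroup WeierstrassCurve Literature.NumberTheory.EllipticCurves
  Literature.NumberTheory.EllipticCurves.ModularForms
  Literature.NumberTheory.EllipticCurves.Kim2025
  Literature.NumberTheory.EllipticCurves.Rank1Residual
  Literature.NumberTheory.EllipticCurves.Rank1Residual.Typed

namespace Summit.BirchSwinnertonDyer.Rank1Residual.Additive.N11

open Summit.BirchSwinnertonDyer.Rank1Residual.X4 Summit.BirchSwinnertonDyer.Rank1Residual.LevelLowering

variable (W : WeierstrassCurve ℚ) [W.IsElliptic] [W.IsGloballyMinimal]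

/-- **`BSD(E,3)` on unit tower rows with `ord₃ ∏ c_ℓ ≤ 2` from a level-lowering certificate and the kim3
cell theorem (every `t`).** For `W/ℚ` globally minimal with the `3`-adic tower onto, `L(E,1) ≠ 0`, a
conductor-level datum `D` with the period transfer `Ω(W) = u·Ω⁺_{D.f}`, `|u|₃ = 1`, `#Ш_an = q'` a
`3`-unit, `ord₃ ∏ c_ℓ ≤ 2`, and a `k`-valued certificate `PlusSymbolLevelLowersOver W 3 D.f ι ℓ` at some
`ℓ ∣ N_E`: granted `KimAtThreeDeepPUB`, Cassels–Tate (`hCT`) and GZK (`hGZK`), `BSDp W 3`. PROOF: the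
certificate gives `∂^{(∞)}(δ̃) ≥ 1` (`one_le_kuriharaPartialInfty_of_plusSymbolLevelLowersOver`); the name
gives `ord₃ #Ш(3) + ∂^{(∞)} ≤ ∂^{(0)} = ord₃ [0]⁺_{D.f} = ord₃(L(E,1)/Ω(W)) = ord₃ q' + ord₃ ∏ c_ℓ ≤ 2`; so
`ord₃ #Ш ≤ 1`, hence `= 0` (`#Ш` is a square), which is `ord₃ q'`.
[cite: Kim2025RefinedTNC, Thm. 1.1 ("BSD")] [cite: SilvermanAEC2009, Thm. X.4.14] [cite: Miller2011LMS, Def. 1.1] -/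
theorem bsdp_three_of_plusSymbolLevelLowersOver_of_kimAtThreeDeepPUB (hKD : KimAtThreeDeepPUB)
    (hCT : exists_casselsTate_pairing (K := ℚ))
    (hGZK : rank_eq_analyticRank_of_analyticRank_le_one)
    (htower : ∀ n : ℕ, W.HasSurjectiveModNGaloisRep (3 ^ n : ℕ)) (hL : W.entireLFunction 1 ≠ 0)
    {N : ℕ} [NeZero N] (D : ModularParametrizationData W N) (hN : W.conductorNorm ℤ = N)
    (hper : ∃ u : ℚ, ‖(u : ℚ_[3])‖ = 1 ∧ W.realPeriodRat = u * plusPeriod D.f)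
    {q' : ℚ} (hq' : shaAn W = (q' : ℂ)) (hv : padicValRat 3 q' = 0)
    {k : Type*} [CommRing k] [Nontrivial k] {ι : ZMod 3 →+* k} {ℓ : ℕ}
    (hcert : PlusSymbolLevelLowersOver W 3 D.f ι ℓ) (hℓ : ℓ ∣ W.conductorNorm ℤ)
    (hc2 : padicValNat 3 W.tamagawaProduct ≤ 2) : BSDp W 3 := by
  haveI : Fact (Nat.Prime 3) := ⟨Nat.prime_three⟩
  have h32 : (3 : ℕ) ≠ 2 := by norm_num
  have hr0 : W.analyticRank = 0 := analyticRank_eq_zero_of_entireLFunction_one_ne_zero hL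
  obtain ⟨hmw, hfin⟩ := hGZK W (by rw [hr0]; exact zero_le_one)
  haveI : Finite W.sha := hfin
  have hirr : W.HasIrreducibleModPGaloisRep 3 :=
    hasIrreducibleModPGaloisRep_of_hasSurjectiveModNGaloisRep W 3 (by simpa using htower 1)
  -- the certificate: every Kurihara number is divisible by 3, `∂^{(∞)} ≥ 1`
  have h1 : (1 : ℕ∞) ≤ kuriharaPartialInfty W 3 D.f :=
    one_le_kuriharaPartialInfty_of_plusSymbolLevelLowersOver W 3 h32 hirr D hN hcert hℓ
  -- the name: `ord₃ #Ш(3) + ∂^{(∞)} ≤ ∂^{(0)} = ord₃ [0]⁺`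
  have hint := forall_padicValRat_ratPlusSymbol_nonneg_of_towerSurj h32 D.isNewformOf htower
  have hint0 : ¬ 3 ∣ (ratPlusSymbol D.f 0).den :=
    not_dvd_den_of_norm_ratCast_le_one
      (D.isNewformOf.norm_ratPlusSymbol_le_one (x := 0) h32 hirr (by simp))
  have hLeq := D.isNewformOf.entireLFunction_one_eq
  have hne : ratPlusSymbol D.f 0 ≠ 0 := by
    intro h0
    apply hL
    rw [hLeq, h0]
    simp
  have hord : kuriharaVanishingOrder W 3 D.f = 0 :=
    kuriharaVanishingOrder_eq_zero_of_ratPlusSymbol_ne_zero W 3 D.f hint0 hne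
  have h2 := padicValNat_sha_add_partialInfty_le_of_kimAtThreeDeepPUB W hKD htower hfin D.f
    D.isNewformOf hint hord
  rw [kuriharaPartial_zero, kuriharaDivIndex_one_eq W 3 D.f hint0 hne] at h2
  have h3 : (padicValNat 3 (Nat.card (AddCommGroup.primaryComponent W.sha 3)) : ℕ∞) + 1 ≤
      ((padicValRat 3 (ratPlusSymbol D.f 0)).toNat : ℕ∞) :=
    le_trans (add_le_add le_rfl h1) h2
  have hnat : padicValNat 3 (Nat.card (AddCommGroup.primaryComponent W.sha 3)) + 1 ≤
      (padicValRat 3 (ratPlusSymbol D.f 0)).toNat := by exact_mod_cast h3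
  have hv0 : 0 ≤ padicValRat 3 (ratPlusSymbol D.f 0) := by
    unfold padicValRat
    rw [padicValNat.eq_zero_of_not_dvd hint0]
    simp
  -- the period transfer: `L(E,1)/Ω(W) = [0]⁺/u`, `ord₃ u = 0`, and `#Ш_an = ([0]⁺/u)·#tors²/∏c`
  obtain ⟨u, hu, hΩ⟩ := hper
  have hu0 : u ≠ 0 := by
    rintro rfl
    rw [Rat.cast_zero, norm_zero] at hu
    exact zero_ne_one hu
  have hΩf : 0 < plusPeriod D.f :=
    IsNewform0.plusPeriod_pos_holds D.isNewformOf.1 D.isNewformOf.coeffField_eq_bot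
  have hq₀ : W.entireLFunction 1 / (W.realPeriodRat : ℂ) = ((ratPlusSymbol D.f 0 / u : ℚ) : ℂ) := by
    rw [hLeq, hΩ]
    have hu' : (u : ℂ) ≠ 0 := by exact_mod_cast hu0
    have hΩf' : ((plusPeriod D.f : ℝ) : ℂ) ≠ 0 := by exact_mod_cast hΩf.ne'
    push_cast
    field_simp
  have hq₀0 : ratPlusSymbol D.f 0 / u ≠ 0 := div_ne_zero hne hu0
  have hvu : padicValRat 3 u = 0 := by
    have hu0' : (u : ℚ_[3]) ≠ 0 := by
      intro h
      rw [h, norm_zero] at hu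
      exact zero_ne_one hu
    have hu1 := hu
    rw [Padic.norm_eq_zpow_neg_valuation hu0', Padic.valuation_ratCast] at hu1
    have hp1 : (1 : ℝ) < ((3 : ℕ) : ℝ) := by norm_num
    have h := (zpow_eq_one_iff_right₀ (zero_le_one.trans hp1.le) hp1.ne').mp hu1
    linarith
  have hsha' := shaAn_eq_of_rankZero_witness W hmw hL hq₀
  have hqq : q' = ratPlusSymbol D.f 0 / u * (W.torsionOrder : ℚ) ^ 2 / (W.tamagawaProduct : ℚ) := by
    exact_mod_cast hq'.symm.trans hsha'
  have hval : padicValRat 3 q' = padicValRat 3 (ratPlusSymbol D.f 0) - padicValNat 3 W.tamagawaProduct := by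
    rw [hqq, Supersingular.padicValRat_shaAn_witness W 3 hirr hq₀0, padicValRat.div hne hu0, hvu, sub_zero]
  rw [hv] at hval
  -- assemble: `ord₃ #Ш(3) + 1 ≤ ord₃ [0]⁺ = ord₃ ∏c ≤ 2`, and `ord₃ #Ш(3)` is even
  have hsha : padicValNat 3 (Nat.card (AddCommGroup.primaryComponent W.sha 3)) =
      padicValNat 3 W.shaOrder := by
    unfold WeierstrassCurve.shaOrder
    exact padicValNat_card_addPrimaryComponent 3
  have hle1 : padicValNat 3 (Nat.card (AddCommGroup.primaryComponent W.sha 3)) ≤ 1 := by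
    have : ((padicValRat 3 (ratPlusSymbol D.f 0)).toNat : ℤ) = padicValNat 3 W.tamagawaProduct := by
      rw [Int.toNat_of_nonneg hv0]; linarith
    omega
  have heven := even_padicValNat_card_shaPrimary_of_casselsTate W 3 hCT hfin
  have h0 : padicValNat 3 (Nat.card (AddCommGroup.primaryComponent W.sha 3)) = 0 := by
    obtain ⟨m, hm⟩ := heven
    omega
  refine bsdp_of_missingPPartAt W 3 hGZK (by rw [hr0]; exact zero_le_one) ⟨q', hq', ?_⟩
  rw [hv, ← hsha, h0, Nat.cast_zero]

end Summit.BirchSwinnertonDyer.Rank1Residual.Additive.N11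

end
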